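import Summits.AtomisticToContinuum.HydrodynamicLimit.Theorems.TwoClocksClampedTransferWindowLDStubTransferActivityMean
import Summits.AtomisticToContinuum.HydrodynamicLimit.Theorems.TwoClocksClampedTransferWindowLDStubClampDeficitBound
import Summits.AtomisticToContinuum.HydrodynamicLimit.Theorems.OneFlightGossipEngineEquilibriumClampedCollisionalWindowLDTranslateCovariance
import Summits.AtomisticToContinuum.HydrodynamicLimit.Theorems.JParityClosureEvenStressEnskogExchangeable
import Literature.Analysis.FluidPDE.HardSphereUniqueness

/-!
# Line `Sketch`, rung R6: the static (τ-uniform) TAGGED transfer-activity tail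
(crux `TwoClocks.ClampedTransferWindowLD` = C′, stmt-AtomisticToContinuum-16623; registered stub
`SketchLine.stub_staticTransferActivityTail` of the lead's skeleton `Cruxes/ClampedTransferWindowLD/Lines/Sketch.lean`,
card `Ideas/clamp-price-static-shell.md`, `StaticTransferActivityTail`)

Support file (`--supports stmt-AtomisticToContinuum-16623`) in the vocabulary of
`Theorems/OneFlightGossipEngineEquilibriumClampedCollisionalWindowLDDefs` (`Flow`, `Phase`, `Rec`, `gibbs`, `window`,
`impulse`, `runAct`, `overflowCount`). Under the homogeneous Gibbs law `G_N`, for EVERY particle `i`, every `τ > 0`,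
`N ≥ 1` and `V > 0`,

  `G_N {V < act_i} ≤ (V (N+1))⁻¹ · 16 σ³ (N+1) · I(u₀, θ₀)`  (`= 16 σ³ I / V`, uniformly in `τ`),

where `act_i = runAct σ τ Φ (window τ N) i` is the window transfer activity of C′. The only new mathematics on top of
the landed extensive bound `lintegral_overflowCount_le` (`E_G #{j : act_j > V} ≤ V⁻¹ · 16 σ³ (N+1) · I`, rungs R4 + R5)
is EXCHANGEABILITY of the tail events under the Gibbs law:

* `collisionSum_comp_perm` — PURE ALGEBRA: the collision sum of `F` along the relabelled curve `t ↦ γ t ∘ π` over any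
  set of times is the collision sum along `γ` of `F` precomposed with the label change `(fst, snd) ↦ (π⁻¹ fst, π⁻¹ snd)`
  of the record (collision times agree, `collisionTimes_comp_perm`; the ordered contact pairs of `γ t ∘ π` are the
  `π × π`-preimage of those of `γ t`, `perm_mem_contactSet_iff`; positions, impact vector and velocities of the record
  are read off the same two particles).
* `runAct_comp_perm` — for a good datum `z` with good relabelling `z ∘ π` the forward orbits relabel
  (`HardSphereFlow.flow_comp_perm_of_nonneg`, forward uniqueness of hard-sphere trajectories), so
  `act_j (z ∘ π) = act_{π j} (z)` (the activity summand reads the first label and the velocities only).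
* `gibbs_setOf_lt_runAct_eq` — `G_N {V < act_j} = G_N {V < act_i}`: the relabelling `z ↦ z ∘ swap i j` preserves `G_N`
  (`EvenStressEnskog.measurePreserving_comp_perm_localGibbsLaw`, a measurable embedding) and `G_N`-a.e. both `z` and
  its relabelling are good (`ae_mem_good_localGibbsLaw`, `HardSphereFlow.ae_comp_perm_mem_good` and
  `localGibbsLaw_absolutelyContinuous`).
* `lintegral_overflowCount_eq` — `∫⁻ #{j : act_j > V} dG_N = Σ_j G_N {V < act_j}` (null-measurability of the tail
  events from `aemeasurable_runAct_window_gibbs`, `0 < σ < 1/2` from `SmallDensity`).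
* `SketchLine.stub_staticTransferActivityTail` — the registered stub: `(N+1) · G_N {V < act_i} = ∫⁻ overflowCount dG_N`,
  then `lintegral_overflowCount_le` and division by `N + 1` in `ℝ≥0∞`.

Sources: I. Gallagher, L. Saint-Raymond, B. Texier, *From Newton to Boltzmann* (2013), §1.1 (1.1.3)–(1.1.4), §4.2
(label-blind hard-sphere dynamics, symmetric `N`-particle laws); H. Spohn, *Large Scale Dynamics of Interacting
Particles* (1991), Part I §2.3. No new definitions. prover-line-stmt-AtomisticToContinuum-16623-c1-0, 2026-08-17.
-/

noncomputable section

open MeasureTheory ProbabilityTheory Set Filter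
open scoped ENNReal BigOperators
open Literature.Analysis.FluidPDE Literature.MathematicalPhysics.KineticTheory
open Literature.Analysis.FunctionSpaces (Torus.partialDeriv Torus.IsSmooth)

namespace Summit.AtomisticToContinuum.HydrodynamicLimit.Theorems.ClampedTransferCoin.SketchLine

/-! ## Relabelling of collision sums along a curve -/

/-- **Relabelling of collision sums along a curve** (pure algebra, any set of times). The collision sum of `F` along
the relabelled curve `t ↦ γ t ∘ π` is the collision sum along `γ` of `F` precomposed with the label change
`(fst, snd) ↦ (π⁻¹ fst, π⁻¹ snd)` of the record: the collision times agree (`collisionTimes_comp_perm`), the ordered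
contact pairs of `γ t ∘ π` are the `π × π`-preimage of those of `γ t` (`perm_mem_contactSet_iff`), and the record of
the pair `(a, b)` read off `γ t ∘ π` has the time, positions, impact vector and velocities of the record of
`(π a, π b)` read off `γ t`. -/
theorem collisionSum_comp_perm {d : Type*} [Fintype d] {X : Type*} {G : Geometry d X} {ε : ℝ} {n : ℕ}
    {M : Type*} [AddCommMonoid M] (γ : ℝ → Config n d X) (π : Equiv.Perm (Fin n)) (S : Set ℝ)
    (F : HardSphereCollisionRecord d X n → M) :
    Literature.Analysis.FluidPDE.collisionSum G ε (fun t => (γ t ∘ π : Config n d X)) S F =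
      Literature.Analysis.FluidPDE.collisionSum G ε γ S
        (fun r => F ⟨r.time, π.symm r.fst, π.symm r.snd, r.fstPos, r.sndPos, r.impactVec, r.preVel, r.postVel⟩) := by
  unfold Literature.Analysis.FluidPDE.collisionSum collisionPairSum
  rw [collisionTimes_comp_perm π γ]
  refine finsum_mem_congr rfl fun t _ => ?_
  refine Finset.sum_equiv (Equiv.prodCongr π π) (fun p => ?_) (fun p _ => ?_)
  · simp only [mem_contactPairs, Equiv.prodCongr_apply, Prod.map_fst, Prod.map_snd, perm_mem_contactSet_iff,
      π.injective.ne_iff]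
  · simp only [HardSphereCollisionRecord.ofConfig, Equiv.prodCongr_apply, Prod.map_fst, Prod.map_snd,
      Function.comp_apply, Equiv.symm_apply_apply]

variable {σ : ℝ} {N : ℕ}

/-- **Relabelling of the running transfer activity.** For a good datum `z` whose relabelling `z ∘ π` is good, the
running activity on `(0, t]` of particle `j` at `z ∘ π` is that of particle `π j` at `z`: the forward orbit of
`z ∘ π` is the relabelled orbit of `z` (`HardSphereFlow.flow_comp_perm_of_nonneg`), a collision sum over
`Ioc 0 t ⊆ Ici 0` only reads the orbit there (`collisionSum_congr_of_eqOn_times`), and the activity summand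
`1{fst = j} · impulse` of the label-changed record is `1{fst = π j} · impulse` of the record (`collisionSum_comp_perm`;
`impulse` reads velocities only). -/
theorem runAct_comp_perm (Φ : Flow σ N) (π : Equiv.Perm (Fin (N + 1))) {z : Phase N} (hz : z ∈ Φ.good)
    (hzπ : (z ∘ π : Phase N) ∈ Φ.good) (τ t : ℝ) (j : Fin (N + 1)) :
    runAct σ τ Φ t j (z ∘ π) = runAct σ τ Φ t (π j) z := by
  unfold runAct
  congr 1
  rw [HardSphereFlow.collisionSum_eq, HardSphereFlow.collisionSum_eq,
    collisionSum_congr_of_eqOn_times (γ' := fun s => (Φ.flow s z ∘ π : Phase N))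
      (fun s hs => Φ.flow_comp_perm_of_nonneg π hz hzπ hs.1.le),
    collisionSum_comp_perm]
  congr 1
  funext r
  simp only [impulse, Equiv.symm_apply_eq]

/-! ## Exchangeability of the activity tails under the Gibbs law -/

/-- **Exchangeability of the transfer-activity tails.** Under the homogeneous Gibbs law the tail events
`{V < act_j}` of all particles have the same probability (for every normalisation `τ`, horizon `t` and level `V`):
the relabelling `z ↦ z ∘ swap i j` is a measure-preserving measurable embedding of `G_N`
(`EvenStressEnskog.measurePreserving_comp_perm_localGibbsLaw`), and `G_N`-almost every datum is good with good
relabelling, where `act_j (z ∘ swap i j) = act_i (z)` (`runAct_comp_perm`). -/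
theorem gibbs_setOf_lt_runAct_eq (a₀ θ₀ : ℝ) (u₀ : V3) (Φ : Flow σ N) (τ t V : ℝ) (i j : Fin (N + 1)) :
    gibbs σ a₀ θ₀ u₀ N Φ {z | V < runAct σ τ Φ t j z} = gibbs σ a₀ θ₀ u₀ N Φ {z | V < runAct σ τ Φ t i z} := by
  set π : Equiv.Perm (Fin (N + 1)) := Equiv.swap i j with hπ
  have hP := EvenStressEnskog.measurePreserving_comp_perm_localGibbsLaw σ (fun _ => a₀) (fun _ => θ₀)
    (fun _ => u₀) N Φ π
  have hemb := EvenStressEnskog.measurableEmbedding_comp_perm (N := N + 1) π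
  refine (hP.measure_preimage_emb hemb {z | V < runAct σ τ Φ t j z}).symm.trans (measure_congr ?_)
  have h1 : ∀ᵐ z ∂(gibbs σ a₀ θ₀ u₀ N Φ), z ∈ Φ.good := ae_mem_good_localGibbsLaw σ _ _ _ N Φ
  have h2 : ∀ᵐ z ∂(gibbs σ a₀ θ₀ u₀ N Φ), (z ∘ π : Phase N) ∈ Φ.good :=
    (localGibbsLaw_absolutelyContinuous σ _ _ _ N Φ).ae_le (Φ.ae_comp_perm_mem_good π)
  refine Filter.eventuallyEq_set.2 ?_
  filter_upwards [h1, h2] with z hz hzπ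
  simp only [Set.mem_preimage, Set.mem_setOf_eq]
  rw [runAct_comp_perm Φ π hz hzπ, hπ, Equiv.swap_apply_right]

/-- **The overflow count is the sum of the indicators of the tail events**, in `ℝ≥0∞`:
`#{j : act_j > V} = Σ_j 1{V < act_j}`. -/
theorem natCast_overflowCount_eq_sum_indicator (τ V : ℝ) (Φ : Flow σ N) (z : Phase N) :
    ((overflowCount σ τ V Φ z : ℕ) : ℝ≥0∞) =
      ∑ j, {z | V < runAct σ τ Φ (window τ N) j z}.indicator (1 : Phase N → ℝ≥0∞) z := by
  classical
  unfold overflowCount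
  rw [Finset.card_filter, Nat.cast_sum]
  refine Finset.sum_congr rfl fun j _ => ?_
  by_cases h : V < runAct σ τ Φ (window τ N) j z
  · rw [if_pos h, Set.indicator_of_mem (by exact h), Pi.one_apply, Nat.cast_one]
  · rw [if_neg h, Set.indicator_of_notMem (by exact h), Nat.cast_zero]

/-- **The mean overflow count is the sum of the tail probabilities**: `∫⁻ #{j : act_j > V} dG_N = Σ_j G_N {V < act_j}`
(`0 < σ < 1/2`: each tail event is `G_N`-null-measurable, `aemeasurable_runAct_window_gibbs`). -/
theorem lintegral_overflowCount_eq (hσ : 0 < σ) (hσ2 : σ < 1 / 2) (a₀ θ₀ : ℝ) (u₀ : V3) (τ V : ℝ)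
    (Φ : Flow σ N) :
    ∫⁻ z, ((overflowCount σ τ V Φ z : ℕ) : ℝ≥0∞) ∂(gibbs σ a₀ θ₀ u₀ N Φ) =
      ∑ j, gibbs σ a₀ θ₀ u₀ N Φ {z | V < runAct σ τ Φ (window τ N) j z} := by
  have hEm : ∀ j, NullMeasurableSet {z | V < runAct σ τ Φ (window τ N) j z} (gibbs σ a₀ θ₀ u₀ N Φ) := fun j =>
    nullMeasurableSet_lt aemeasurable_const (aemeasurable_runAct_window_gibbs hσ hσ2 a₀ θ₀ u₀ τ Φ j)
  calc ∫⁻ z, ((overflowCount σ τ V Φ z : ℕ) : ℝ≥0∞) ∂(gibbs σ a₀ θ₀ u₀ N Φ)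
      = ∫⁻ z, ∑ j, {z | V < runAct σ τ Φ (window τ N) j z}.indicator (1 : Phase N → ℝ≥0∞) z
          ∂(gibbs σ a₀ θ₀ u₀ N Φ) := lintegral_congr fun z => natCast_overflowCount_eq_sum_indicator τ V Φ z
    _ = ∑ j, ∫⁻ z, {z | V < runAct σ τ Φ (window τ N) j z}.indicator (1 : Phase N → ℝ≥0∞) z
          ∂(gibbs σ a₀ θ₀ u₀ N Φ) := lintegral_finsetSum' _ fun j _ => aemeasurable_const.indicator₀ (hEm j)
    _ = ∑ j, gibbs σ a₀ θ₀ u₀ N Φ {z | V < runAct σ τ Φ (window τ N) j z} :=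
        Finset.sum_congr rfl fun j _ => lintegral_indicator_one₀ (hEm j)

/-- **The tagged tail against the mean overflow count**: `(N+1) · G_N {V < act_i} = ∫⁻ #{j : act_j > V} dG_N`
(exchangeability `gibbs_setOf_lt_runAct_eq` in `lintegral_overflowCount_eq`). -/
theorem succ_mul_gibbs_setOf_lt_runAct_eq (hσ : 0 < σ) (hσ2 : σ < 1 / 2) (a₀ θ₀ : ℝ) (u₀ : V3) (τ V : ℝ)
    (Φ : Flow σ N) (i : Fin (N + 1)) :
    ((N : ℝ≥0∞) + 1) * gibbs σ a₀ θ₀ u₀ N Φ {z | V < runAct σ τ Φ (window τ N) i z} =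
      ∫⁻ z, ((overflowCount σ τ V Φ z : ℕ) : ℝ≥0∞) ∂(gibbs σ a₀ θ₀ u₀ N Φ) := by
  rw [lintegral_overflowCount_eq hσ hσ2 a₀ θ₀ u₀ τ V Φ,
    Finset.sum_congr rfl fun j _ => gibbs_setOf_lt_runAct_eq a₀ θ₀ u₀ Φ τ (window τ N) V i j,
    Finset.sum_const, Finset.card_univ, Fintype.card_fin, nsmul_eq_mul, Nat.cast_succ]

/-! ## The registered stub -/

/-- **R6 · static (τ-uniform) TAGGED transfer-activity tail** (registered stub of line `Sketch`; card
`StaticTransferActivityTail`, sharpened to the tree's constant): under the homogeneous Gibbs law, for EVERY particle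
`i`, every `τ > 0`, `N ≥ 1`, `V > 0`,
`G_N{V < act_i} ≤ (V (N+1))⁻¹ · 16 σ³ (N+1) · ∫ ‖w − v‖ · ‖v − w‖ (1 + ‖v + w‖/2) dN(u₀,θ₀)^{⊗2}` (= `16 σ³ I / V`):
exchangeability of the tail events under relabelling (`succ_mul_gibbs_setOf_lt_runAct_eq`) turns the landed extensive
bound `lintegral_overflowCount_le` (`E_G #{j : act_j > V} ≤ V⁻¹ · 16 σ³ (N+1) · I`) into the tagged one, dividing by
`N + 1`. Markov-level, so it does NOT decay in `τ`. -/
theorem stub_staticTransferActivityTail :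
    ∀ {σ : ℝ}, SmallDensity uniformProfile σ → ∀ (a₀ θ₀ : ℝ) (u₀ : V3), 0 < a₀ → 0 < θ₀ → ∀ {N : ℕ}, 1 ≤ N →
      ∀ (Φ : Flow σ N) (τ : ℝ), 0 < τ → ∀ (V : ℝ), 0 < V → ∀ i : Fin (N + 1),
        (gibbs σ a₀ θ₀ u₀ N Φ) {z | V < runAct σ τ Φ (window τ N) i z} ≤
          (ENNReal.ofReal (V * ((N : ℝ) + 1)))⁻¹ * (ENNReal.ofReal (16 * σ ^ 3 * ((N : ℝ) + 1)) *
            ∫⁻ p, ENNReal.ofReal (‖p.2 - p.1‖ * (‖p.1 - p.2‖ * (1 + ‖p.1 + p.2‖ / 2)))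
              ∂((gaussMeasure u₀ θ₀).prod (gaussMeasure u₀ θ₀))) := by
  intro σ hsm a₀ θ₀ u₀ ha hθ N hN Φ τ hτ V hV i
  have key := lintegral_overflowCount_le hsm a₀ θ₀ u₀ ha hθ hN Φ hτ hV
  rw [← succ_mul_gibbs_setOf_lt_runAct_eq hsm.σ_pos hsm.σ_lt_half a₀ θ₀ u₀ τ V Φ i] at key
  -- constants: `(ofReal (V (N+1)))⁻¹ = (ofReal V)⁻¹ (N+1)⁻¹`
  have hN0 : (N : ℝ≥0∞) + 1 ≠ 0 := by positivity
  have hNtop : (N : ℝ≥0∞) + 1 ≠ ⊤ := ENNReal.add_ne_top.2 ⟨ENNReal.natCast_ne_top N, ENNReal.one_ne_top⟩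
  have hV0 : ENNReal.ofReal V ≠ 0 := (ENNReal.ofReal_pos.2 hV).ne'
  have hinv : (ENNReal.ofReal (V * ((N : ℝ) + 1)))⁻¹ = ((N : ℝ≥0∞) + 1)⁻¹ * (ENNReal.ofReal V)⁻¹ := by
    have hc : ENNReal.ofReal ((N : ℝ) + 1) = (N : ℝ≥0∞) + 1 := by
      rw [← Nat.cast_succ, ENNReal.ofReal_natCast, Nat.cast_succ]
    rw [ENNReal.ofReal_mul hV.le, hc, ENNReal.mul_inv (Or.inl hV0) (Or.inl ENNReal.ofReal_ne_top), mul_comm]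
  calc gibbs σ a₀ θ₀ u₀ N Φ {z | V < runAct σ τ Φ (window τ N) i z}
      = ((N : ℝ≥0∞) + 1)⁻¹ *
          (((N : ℝ≥0∞) + 1) * gibbs σ a₀ θ₀ u₀ N Φ {z | V < runAct σ τ Φ (window τ N) i z}) := by
        rw [← mul_assoc, ENNReal.inv_mul_cancel hN0 hNtop, one_mul]
    _ ≤ ((N : ℝ≥0∞) + 1)⁻¹ * ((ENNReal.ofReal V)⁻¹ * (ENNReal.ofReal (16 * σ ^ 3 * ((N : ℝ) + 1)) *
            ∫⁻ p, ENNReal.ofReal (‖p.2 - p.1‖ * (‖p.1 - p.2‖ * (1 + ‖p.1 + p.2‖ / 2)))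
              ∂((gaussMeasure u₀ θ₀).prod (gaussMeasure u₀ θ₀)))) := mul_le_mul_right key _
    _ = _ := by rw [hinv]; exact (mul_assoc _ _ _).symm

end Summit.AtomisticToContinuum.HydrodynamicLimit.Theorems.ClampedTransferCoin.SketchLine

end
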